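import Summits.Ventures.QEC.CircuitDistance.PortCycleSemantics
import HarnessLib

/-!
# Schedule-parametrised syndrome cycles: the depth-7 CNOT orders of the BB syndrome-measurement circuit
# (venture QEC, experiment cell CDX, Q4 lane — DEFINITIONS, an ANCHOR lemma and DATA only; nothing here asserts a value of `d_circ`)

Provenance: drafted by qec-cdx-idea-2 g2 (director-qec R153 (1)(a)(b), 2026-08-28), typed by qec-cdx-type-2 (an independent
re-derivation of the same objects agrees netlist for netlist), statement audit qec-cdx-crit-1. No landed declaration is edited.
Source: [BravyiEtAl2024] = arXiv:2308.07915, SI §5 p. 12 L9–18 (depth 8; at most one CNOT layer per register pair per round;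
`q(X)` always control, `q(Z)` always target; `MeasZ` in Round 7, `MeasX` and `InitZ` in Round 8) and p. 14 L26–30 ("935 depth-7
alternatives … obtained from the circuit defined in Eq. (SCunitary_part) by applying the gate layers CNOT_{A_i} and CNOT_{B_j} in
a different order … all 936 variants of the syndrome cycle give rise to syndrome measurement circuits with distance d_circ ≤ 10").

WHAT THIS FILE DOES. `SyndromeCycle.lean` fixes print's circuit Eq. (SCunitary_part) as the event list `cycleEvents c`; its twelve
CNOT layers `Layer` (= {A₁,A₂,A₃} × {X→L, R→Z} ∪ {B₁,B₂,B₃} × {X→R, L→Z}) name a layer by LABEL and REGISTER PAIR, not by round,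
so only their TIME ORDER is hard-wired. Here: (1) `Gen.*` — `run1`, `flipX/Z`, `dataX/Z`, `detX/Z`, `Undetectable`,
`LogicalError`, `circuitDistance`, `HasLogicalFaultOfWeightAtMostAt` re-stated over an ARBITRARY event list `es : List Ev` in
place of `allEvents Nc`, each with the `rfl` lemma that at `es = allEvents Nc` it IS the landed notion (`Fault`, `Loc`,
`faultCount`, `Ev`, `applyEv`, `inject`, `simulate`, `bsum`, detectors and logical error reused UNCHANGED — nothing re-modelled),
plus the `sInf` bookkeeping `Gen.circuitDistance_eq_succ` used to pre-state the decided forms of CDX-Q4 (`ClaimsQ4.lean`);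
(2) `SMSchedule` — the round of each layer — with the Boolean checks `templateOK` (print's depth-8 template: one `X`-type layer in
each of rounds 2–7, one `Z`-type layer in each of rounds 1–6, each data register in at most one layer per round; `InitX`@1,
`MeasZ`@7, `MeasX`,`InitZ`@8 fixed) and `parityOK` (criterion O1 below), the event lists `cycleEventsₛ σ c` / `allEventsₛ σ Nc`,
and `run1ₛ`, `Undetectableₛ`, `LogicalErrorₛ`, `circuitDistanceₛ`, `HasLogicalFaultOfWeightAtMost(At)ₛ` := `Gen.*` at
`allEventsₛ σ Nc`; (3) DATA `sched204` (print's order), `sched345`, `sched324` (numbering OURS = index in qec-cdx-idea-2's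
enumeration `orders936.json`, criterion O1; print lists no enumeration, so `#k` is matched to no printed variant one-to-one —
RIDER L), their explicit one-cycle netlists, and the ANCHOR `cycleEventsₛ sched204 c = cycleEvents c`, whence
`circuitDistanceₛ sched204 S Nc = circuitDistance S Nc` and `HasLogicalFaultOfWeightAtMostₛ sched204 S w ↔
HasLogicalFaultOfWeightAtMost S w` for EVERY `S`: every word of record about print's circuit is literally the `sched204` instance.

IDLE SLOTS (the one modelling sentence). `IdleSlot = {L1, R7, L8, R8}` names print's data-register gaps. For a template-valid
schedule each data register `q(L)`, `q(R)` carries six CNOT layers in rounds 1–7, hence is idle in round 8 and in exactly ONE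
round among 1–7 (round 1 resp. 7 for print's order — whence the constructor names, which are kept): `cycleEventsₛ` places
`Ev.idle c .L1` (resp. `.R7`) in THAT round, `Ev.idle c .L8 / .R8` in round 8. So every schedule has print's `2n` idle locations
and `98·n` single-fault realisations per cycle (SI p. 15 L60–66), on the unchanged `Loc` type.

CRITERION O1 (honest framing). `parityOK` is qec-cdx-idea-2's LEMMA O1 (CARD-A §1): an order measures every stabiliser correctly
iff for all `p, q ∈ {1,2,3}` `[r(AₚX→L) < r(B_qL→Z)] + [r(B_qX→R) < r(AₚR→Z)] ≡ 0 (mod 2)`. The template has exactly `936`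
solutions — print's count — and the equivalence of O1 with determinism of the fault-free circuit was checked exhaustively
OUTSIDE Lean (tableau check of all `25 920` template assignments; `templateOK ∧ parityOK`, re-implemented independently by the
typist, passes exactly `936` of the `6!·6!` injective fillings, namely the entries of `orders936.json`). It is NOT proved here and
nothing below depends on it logically: `circuitDistanceₛ σ` is a function of the circuit `σ` defines; O1 is what makes that
circuit a syndrome-measurement circuit in print's sense. `sched204`, `sched345`, `sched324` satisfy it (`decide`).
-/

namespace Summit.Ventures.QEC.CircuitDistance

open Literature.InformationTheory.QuantumCodes

variable {ℓ m : ℕ}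

/-! ## 1. The semantics of `SyndromeCycle.lean` over an arbitrary event list (`Gen.*`), with `rfl` anchors -/

namespace Gen

variable [NeZero ℓ] [NeZero m]

/-- Final state produced by the single fault `f` when the circuit is the event list `es` (cf. `run1`). -/
def run1 (S : SMCode ℓ m) (es : List Ev) (f : Fault ℓ m) : State ℓ m := simulate S f es State.init

/-- Total flip of the `X`-check outcome `(c, i)` caused by `F` (cf. `flipX`). -/
def flipX (S : SMCode ℓ m) (es : List Ev) (F : Finset (Fault ℓ m)) (c : ℕ) (i : BB.Mono ℓ m) : Bool :=
  bsum F fun f => (run1 S es f).mX c i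

/-- Total flip of the `Z`-check outcome `(c, i)` (cf. `flipZ`). -/
def flipZ (S : SMCode ℓ m) (es : List Ev) (F : Finset (Fault ℓ m)) (c : ℕ) (i : BB.Mono ℓ m) : Bool :=
  bsum F fun f => (run1 S es f).mZ c i

/-- Residual `X`-type data error (cf. `dataX`). -/
def dataX (S : SMCode ℓ m) (es : List Ev) (F : Finset (Fault ℓ m)) : BB.Mono ℓ m ⊕ BB.Mono ℓ m → ZMod 2 :=
  fun q => if bsum F (fun f => ((run1 S es f).frame (q.elim (fun i => (Reg.L, i)) fun i => (Reg.R, i))).1)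
    then 1 else 0

/-- Residual `Z`-type data error (cf. `dataZ`). -/
def dataZ (S : SMCode ℓ m) (es : List Ev) (F : Finset (Fault ℓ m)) : BB.Mono ℓ m ⊕ BB.Mono ℓ m → ZMod 2 :=
  fun q => if bsum F (fun f => ((run1 S es f).frame (q.elim (fun i => (Reg.L, i)) fun i => (Reg.R, i))).2)
    then 1 else 0

/-- `X`-check detector `(t, i)` of the `Nc`-cycle circuit with event list `es` (cf. `detX`). -/
def detX (S : SMCode ℓ m) (Nc : ℕ) (es : List Ev) (F : Finset (Fault ℓ m)) (t : ℕ) (i : BB.Mono ℓ m) : Bool :=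
  if t = 0 then false
  else if t ≤ Nc then xor (flipX S es F t i) (flipX S es F (t - 1) i)
  else if t = Nc + 1 then xor (decide ((S.toCode.HX.mulVec (dataZ S es F)) i = 1)) (flipX S es F Nc i)
  else false

/-- `Z`-check detector `(t, i)` (cf. `detZ`). -/
def detZ (S : SMCode ℓ m) (Nc : ℕ) (es : List Ev) (F : Finset (Fault ℓ m)) (t : ℕ) (i : BB.Mono ℓ m) : Bool :=
  if t = 0 then false
  else if t ≤ Nc then xor (flipZ S es F t i) (flipZ S es F (t - 1) i)
  else if t = Nc + 1 then xor (decide ((S.toCode.HZ.mulVec (dataX S es F)) i = 1)) (flipZ S es F Nc i)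
  else false

/-- Undetectable fault set (cf. `Undetectable`): every fault sits on an event of `es` and no detector fires. -/
def Undetectable (S : SMCode ℓ m) (Nc : ℕ) (es : List Ev) (F : Finset (Fault ℓ m)) : Prop :=
  (∀ f ∈ F, f.ev ∈ es) ∧ ∀ t i, detX S Nc es F t i = false ∧ detZ S Nc es F t i = false

/-- The residual data error is a logical error (cf. `LogicalError`). -/
def LogicalError (S : SMCode ℓ m) (es : List Ev) (F : Finset (Fault ℓ m)) : Prop :=
  ¬ (dataX S es F ∈ S.toCode.css.rowSpX ∧ dataZ S es F ∈ S.toCode.css.swap.rowSpX)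

/-- Circuit-level distance of the `Nc`-cycle circuit with event list `es` (cf. `circuitDistance`; `sInf`, junk value `0`). -/
noncomputable def circuitDistance (S : SMCode ℓ m) (Nc : ℕ) (es : List Ev) : ℕ :=
  sInf {w | ∃ F : Finset (Fault ℓ m), Undetectable S Nc es F ∧ LogicalError S es F ∧ faultCount F = w}

/-- An undetectable logical fault set of at most `w` faulty operations exists (cf. `HasLogicalFaultOfWeightAtMostAt`). -/
def HasLogicalFaultOfWeightAtMostAt (S : SMCode ℓ m) (Nc : ℕ) (es : List Ev) (w : ℕ) : Prop :=
  ∃ F : Finset (Fault ℓ m), Undetectable S Nc es F ∧ LogicalError S es F ∧ faultCount F ≤ w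

/-! ### Anchors: at `es = allEvents Nc` these ARE the landed notions (all `rfl`). -/

/-- Anchor: `Gen.run1` at `allEvents Nc` is `run1`. -/
theorem run1_allEvents (S : SMCode ℓ m) (Nc : ℕ) : run1 S (allEvents Nc) = CircuitDistance.run1 S Nc := rfl
/-- Anchor: `Gen.flipX` at `allEvents Nc` is `flipX`. -/
theorem flipX_allEvents (S : SMCode ℓ m) (Nc : ℕ) : flipX S (allEvents Nc) = CircuitDistance.flipX S Nc := rfl
/-- Anchor: `Gen.flipZ` at `allEvents Nc` is `flipZ`. -/
theorem flipZ_allEvents (S : SMCode ℓ m) (Nc : ℕ) : flipZ S (allEvents Nc) = CircuitDistance.flipZ S Nc := rfl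
/-- Anchor: `Gen.dataX` at `allEvents Nc` is `dataX`. -/
theorem dataX_allEvents (S : SMCode ℓ m) (Nc : ℕ) : dataX S (allEvents Nc) = CircuitDistance.dataX S Nc := rfl
/-- Anchor: `Gen.dataZ` at `allEvents Nc` is `dataZ`. -/
theorem dataZ_allEvents (S : SMCode ℓ m) (Nc : ℕ) : dataZ S (allEvents Nc) = CircuitDistance.dataZ S Nc := rfl
/-- Anchor: `Gen.detX` at `allEvents Nc` is `detX`. -/
theorem detX_allEvents (S : SMCode ℓ m) (Nc : ℕ) : detX S Nc (allEvents Nc) = CircuitDistance.detX S Nc := rfl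
/-- Anchor: `Gen.detZ` at `allEvents Nc` is `detZ`. -/
theorem detZ_allEvents (S : SMCode ℓ m) (Nc : ℕ) : detZ S Nc (allEvents Nc) = CircuitDistance.detZ S Nc := rfl
/-- Anchor: `Gen.Undetectable` at `allEvents Nc` is `Undetectable`. -/
theorem undetectable_allEvents (S : SMCode ℓ m) (Nc : ℕ) :
    Undetectable S Nc (allEvents Nc) = CircuitDistance.Undetectable S Nc := rfl
/-- Anchor: `Gen.LogicalError` at `allEvents Nc` is `LogicalError`. -/
theorem logicalError_allEvents (S : SMCode ℓ m) (Nc : ℕ) :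
    LogicalError S (allEvents Nc) = CircuitDistance.LogicalError S Nc := rfl
/-- Anchor: `Gen.circuitDistance` at `allEvents Nc` is `circuitDistance`. -/
theorem circuitDistance_allEvents (S : SMCode ℓ m) (Nc : ℕ) :
    circuitDistance S Nc (allEvents Nc) = CircuitDistance.circuitDistance S Nc := rfl
/-- Anchor: `Gen.HasLogicalFaultOfWeightAtMostAt` at `allEvents Nc` is `HasLogicalFaultOfWeightAtMostAt`. -/
theorem hasLogicalFaultOfWeightAtMostAt_allEvents (S : SMCode ℓ m) (Nc w : ℕ) :
    HasLogicalFaultOfWeightAtMostAt S Nc (allEvents Nc) w = CircuitDistance.HasLogicalFaultOfWeightAtMostAt S Nc w := rfl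

/-- `sInf` bookkeeping (used to pre-state decided forms): no undetectable logical set of weight `≤ w` and one of weight
`≤ w + 1` give `circuitDistance = w + 1`. -/
theorem circuitDistance_eq_succ {S : SMCode ℓ m} {Nc : ℕ} {es : List Ev} {w : ℕ}
    (hno : ¬ HasLogicalFaultOfWeightAtMostAt S Nc es w) (hyes : HasLogicalFaultOfWeightAtMostAt S Nc es (w + 1)) :
    circuitDistance S Nc es = w + 1 := by
  obtain ⟨F, hU, hL, hc⟩ := hyes
  have hF : faultCount F = w + 1 := le_antisymm hc (by by_contra h; exact hno ⟨F, hU, hL, by omega⟩)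
  have hmem : (w + 1) ∈ {w' | ∃ F : Finset (Fault ℓ m), Undetectable S Nc es F ∧ LogicalError S es F ∧ faultCount F = w'} :=
    ⟨F, hU, hL, hF⟩
  refine le_antisymm (Nat.sInf_le hmem) ?_
  obtain ⟨F', hU', hL', hc'⟩ := Nat.sInf_mem ⟨w + 1, hmem⟩
  by_contra h
  exact hno ⟨F', hU', hL', by unfold circuitDistance at h; omega⟩

/-- Monotonicity in the weight. -/
theorem hasLogicalFaultOfWeightAtMostAt_mono {S : SMCode ℓ m} {Nc : ℕ} {es : List Ev} {w w' : ℕ} (h : w ≤ w')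
    (hw : HasLogicalFaultOfWeightAtMostAt S Nc es w) : HasLogicalFaultOfWeightAtMostAt S Nc es w' := by
  obtain ⟨F, hU, hL, hc⟩ := hw
  exact ⟨F, hU, hL, le_trans hc h⟩

end Gen

/-! ## 2. Schedules: the twelve CNOT layers ↦ rounds; print's template and criterion O1 as decidable predicates -/

/-- The DATA register a layer acts on: the target of an `X`-type layer (control `q(X)`), the control of a `Z`-type layer
(target `q(Z)`). -/
def Layer.dataReg (l : Layer) : Reg := if l.ctrl = Reg.X then l.tgt else l.ctrl

/-- The `X`-type layer `CNOT_{Aₚ}(X→L)`, `p = 0,1,2` for `A₁,A₂,A₃`. -/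
def Layer.xl : Fin 3 → Layer := ![.A1XL, .A2XL, .A3XL]
/-- The `X`-type layer `CNOT_{B_q}(X→R)`. -/
def Layer.xr : Fin 3 → Layer := ![.B1XR, .B2XR, .B3XR]
/-- The `Z`-type layer `CNOT_{B_q}(L→Z)` (matrix `B_qᵀ`). -/
def Layer.lz : Fin 3 → Layer := ![.B1LZ, .B2LZ, .B3LZ]
/-- The `Z`-type layer `CNOT_{Aₚ}(R→Z)` (matrix `Aₚᵀ`). -/
def Layer.rz : Fin 3 → Layer := ![.A1RZ, .A2RZ, .A3RZ]

/-- The twelve CNOT layers, listed (verbatim the list `Layer.all` of `PortKinds.lean`, which is not imported here so that this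
statement file depends on the cycle semantics only). -/
def Layer.listed : List Layer := [.A1RZ, .A2XL, .A3RZ, .B2XR, .B1LZ, .B1XR, .B2LZ, .B3XR, .B3LZ, .A1XL, .A2RZ, .A3XL]

/-- Every layer is listed. -/
theorem Layer.mem_listed (l : Layer) : l ∈ Layer.listed := by
  cases l <;> decide

/-- A CNOT SCHEDULE of the depth-8 syndrome cycle: the round (meant to lie in `1 … 7`) of each of the twelve CNOT layers.
`InitX`@1, `MeasZ`@7, `MeasX`+`InitZ`@8 are fixed by the template (SI p. 12 L18). [cite: BravyiEtAl2024, SI §5 p. 12 L18, p. 14 L26–30] -/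
structure SMSchedule where
  /-- round of each CNOT layer -/
  round : Layer → ℕ

/-- Build a schedule from the rounds of `A₁,A₂,A₃ (X→L)`, `B₁,B₂,B₃ (X→R)`, `B₁,B₂,B₃ (L→Z)`, `A₁,A₂,A₃ (R→Z)` — the format of
`orders936.json` (`XL`, `XR`, `ZL`, `ZR` lists of (round, index)). -/
def SMSchedule.ofRounds (xl xr lz rz : Fin 3 → ℕ) : SMSchedule :=
  ⟨fun l => match l with
    | .A1XL => xl 0 | .A2XL => xl 1 | .A3XL => xl 2
    | .B1XR => xr 0 | .B2XR => xr 1 | .B3XR => xr 2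
    | .B1LZ => lz 0 | .B2LZ => lz 1 | .B3LZ => lz 2
    | .A1RZ => rz 0 | .A2RZ => rz 1 | .A3RZ => rz 2⟩

namespace SMSchedule

/-- The layers scheduled in round `r` that satisfy `p`. -/
def layersAt (σ : SMSchedule) (r : ℕ) (p : Layer → Bool) : List Layer :=
  Layer.listed.filter fun l => p l && (σ.round l == r)

/-- PRINT'S DEPTH-8 TEMPLATE (SI p. 12 L18, as a decidable predicate): exactly one `X`-type layer (control `q(X)`) in each of the
rounds 2–7 and exactly one `Z`-type layer (target `q(Z)`) in each of the rounds 1–6 (so the six layers of each type are used once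
each and `q(X)`/`q(Z)` are busy in 2–7 / 1–6, free for `InitX`@1, `MeasZ`@7, `MeasX`,`InitZ`@8), and each data register `q(L)`,
`q(R)` meets at most one layer per round (every round is depth 1). -/
def templateOK (σ : SMSchedule) : Bool :=
  ([2, 3, 4, 5, 6, 7].all fun r => (σ.layersAt r fun l => l.ctrl == Reg.X).length == 1) &&
  ([1, 2, 3, 4, 5, 6].all fun r => (σ.layersAt r fun l => l.tgt == Reg.Z).length == 1) &&
  ([1, 2, 3, 4, 5, 6, 7].all fun r =>
    decide ((σ.layersAt r fun l => l.dataReg == Reg.L).length ≤ 1) &&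
    decide ((σ.layersAt r fun l => l.dataReg == Reg.R).length ≤ 1))

/-- CRITERION O1 of the cell (correct stabiliser measurement; see the module docstring for its status): for all `p, q`,
`[round(AₚX→L) < round(B_qL→Z)] + [round(B_qX→R) < round(AₚR→Z)]` is even. -/
def parityOK (σ : SMSchedule) : Bool :=
  (List.finRange 3).all fun p => (List.finRange 3).all fun q =>
    ((if σ.round (Layer.xl p) < σ.round (Layer.lz q) then 1 else 0) +
      (if σ.round (Layer.xr q) < σ.round (Layer.rz p) then 1 else 0)) % 2 == 0

/-- A VALID order = one of the 936: print's template and criterion O1. -/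
def Valid (σ : SMSchedule) : Prop := σ.templateOK = true ∧ σ.parityOK = true

/-- The events of round `r ∈ {1,…,7}` of the cycle, at cycle tag `0` (re-tagged by `cycleEventsₛ`): `InitX` (round 1), the `X`-type
layer of the round if any, the `Z`-type layer if any, `MeasZ` (round 7), then the idle slot of `q(L)` / `q(R)` if that register meets
no layer in this round (named `.L1` / `.R7`, see IDLE SLOTS in the module docstring). Operations of one round act on disjoint qubits,
so only the round matters, not the order inside this list; the order chosen reproduces `cycleEvents` literally for print's schedule. -/
def roundEvents (σ : SMSchedule) (r : ℕ) : List Ev :=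
  (if r = 1 then [Ev.initX 0] else []) ++
  ((σ.layersAt r fun l => l.ctrl == Reg.X).map fun l => Ev.cnot 0 l) ++
  ((σ.layersAt r fun l => l.tgt == Reg.Z).map fun l => Ev.cnot 0 l) ++
  (if r = 7 then [Ev.measZ 0] else []) ++
  (if (σ.layersAt r fun l => l.dataReg == Reg.L).isEmpty then [Ev.idle 0 .L1] else []) ++
  (if (σ.layersAt r fun l => l.dataReg == Reg.R).isEmpty then [Ev.idle 0 .R7] else [])

/-- One cycle at cycle tag `0`: rounds 1–7, then round 8 = `MeasX`, `InitZ` and the two round-8 data idles. -/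
def template (σ : SMSchedule) : List Ev :=
  σ.roundEvents 1 ++ σ.roundEvents 2 ++ σ.roundEvents 3 ++ σ.roundEvents 4 ++ σ.roundEvents 5 ++ σ.roundEvents 6 ++
    σ.roundEvents 7 ++ [Ev.measX 0, Ev.initZ 0, Ev.idle 0 .L8, Ev.idle 0 .R8]

end SMSchedule

/-- The events of cycle `c ≥ 1` of the circuit with schedule `σ`, in time order (cf. `cycleEvents`): the one-cycle template
re-tagged with cycle `c` (`Ev.retag` of `PortCycleSemantics.lean`). -/
def cycleEventsₛ (σ : SMSchedule) (c : ℕ) : List Ev := σ.template.map (Ev.retag c)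

/-- All events of the `Nc`-cycle circuit with schedule `σ`: cycles `1 … Nc` (cf. `allEvents`; the `InitZ` before cycle 1 ideal, as there). -/
def allEventsₛ (σ : SMSchedule) (Nc : ℕ) : List Ev :=
  (List.range Nc).flatMap fun c => cycleEventsₛ σ (c + 1)

section
variable [NeZero ℓ] [NeZero m]

/-- Final state of the single fault `f` in the `Nc`-cycle circuit with schedule `σ`. -/
def run1ₛ (σ : SMSchedule) (S : SMCode ℓ m) (Nc : ℕ) (f : Fault ℓ m) : State ℓ m := Gen.run1 S (allEventsₛ σ Nc) f

/-- Undetectable fault set in the `Nc`-cycle circuit with schedule `σ`. -/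
def Undetectableₛ (σ : SMSchedule) (S : SMCode ℓ m) (Nc : ℕ) (F : Finset (Fault ℓ m)) : Prop :=
  Gen.Undetectable S Nc (allEventsₛ σ Nc) F

/-- Logical residual error in the `Nc`-cycle circuit with schedule `σ`. -/
def LogicalErrorₛ (σ : SMSchedule) (S : SMCode ℓ m) (Nc : ℕ) (F : Finset (Fault ℓ m)) : Prop :=
  Gen.LogicalError S (allEventsₛ σ Nc) F

/-- **Circuit-level distance of the variant `σ`**: `d_circ` of the `Nc`-cycle SM circuit of `S` run with CNOT schedule `σ`
(print's definition p. 5 / SI p. 17, semantics of `SyndromeCycle.lean`, event list `allEventsₛ σ Nc`). -/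
noncomputable def circuitDistanceₛ (σ : SMSchedule) (S : SMCode ℓ m) (Nc : ℕ) : ℕ :=
  Gen.circuitDistance S Nc (allEventsₛ σ Nc)

/-- The `Nc`-cycle circuit with schedule `σ` admits an undetectable logical fault set of at most `w` faulty operations. -/
def HasLogicalFaultOfWeightAtMostAtₛ (σ : SMSchedule) (S : SMCode ℓ m) (Nc w : ℕ) : Prop :=
  Gen.HasLogicalFaultOfWeightAtMostAt S Nc (allEventsₛ σ Nc) w

/-- … in SOME number of cycles (the shape of the pre-registered question CDX-Q4). -/
def HasLogicalFaultOfWeightAtMostₛ (σ : SMSchedule) (S : SMCode ℓ m) (w : ℕ) : Prop :=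
  ∃ Nc : ℕ, HasLogicalFaultOfWeightAtMostAtₛ σ S Nc w

/-- `sInf` bookkeeping for a variant: no set of weight `≤ w`, a set of weight `≤ w+1` ⟹ `circuitDistanceₛ = w+1`. -/
theorem circuitDistanceₛ_eq_succ {σ : SMSchedule} {S : SMCode ℓ m} {Nc w : ℕ}
    (hno : ¬ HasLogicalFaultOfWeightAtMostAtₛ σ S Nc w) (hyes : HasLogicalFaultOfWeightAtMostAtₛ σ S Nc (w + 1)) :
    circuitDistanceₛ σ S Nc = w + 1 :=
  Gen.circuitDistance_eq_succ hno hyes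

end

/-! ## 3. Data: print's order (#204) and orders #345, #324; the anchor -/

/-- PRINT'S ORDER Eq. (SCunitary_part) = #204 of `orders936.json`: `A₁,A₂,A₃ (X→L)` in rounds 6, 2, 7; `B₁,B₂,B₃ (X→R)` in 4, 3, 5;
`B₁,B₂,B₃ (L→Z)` in 3, 4, 5; `A₁,A₂,A₃ (R→Z)` in 1, 6, 2. [cite: BravyiEtAl2024, SI §5 Eq. (SCunitary_part)] -/
def sched204 : SMSchedule := .ofRounds ![6, 2, 7] ![4, 3, 5] ![3, 4, 5] ![1, 6, 2]

/-- ORDER #345 (numbering ours: `orders936.json[345]`, criterion O1; class Ra1+Ra2∣La1+La2 of cdx/idea-2/CARD-A):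
R1 `InitX, A₂(R→Z)` | R2 `A₃(X→L), A₁(R→Z)` | R3 `B₁(X→R), B₂(L→Z)` | R4 `B₃(X→R), B₃(L→Z)` | R5 `B₂(X→R), B₁(L→Z)` |
R6 `A₁(X→L), A₃(R→Z)` | R7 `A₂(X→L), MeasZ` | R8 `MeasX, InitZ`; i.e. rounds `X→L` 6, 7, 2; `X→R` 3, 5, 4; `L→Z` 5, 3, 4; `R→Z` 2, 1, 6.
The cell's Q4 PRIMARY candidate (R151 (1)); not a relabelling of print's order (no `SMCode` instance renders it). -/
def sched345 : SMSchedule := .ofRounds ![6, 7, 2] ![3, 5, 4] ![5, 3, 4] ![2, 1, 6]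

/-- ORDER #324 (numbering ours, same class; record-only companion of #345): rounds `X→L` 6, 7, 2; `X→R` 3, 4, 5; `L→Z` 3, 4, 5;
`R→Z` 1, 2, 6. -/
def sched324 : SMSchedule := .ofRounds ![6, 7, 2] ![3, 4, 5] ![3, 4, 5] ![1, 2, 6]

/-- Print's order passes the template and criterion O1. -/
theorem sched204_valid : sched204.Valid := ⟨by decide, by decide⟩

/-- Order #345 passes the template and criterion O1. -/
theorem sched345_valid : sched345.Valid := ⟨by decide, by decide⟩

/-- Order #324 passes the template and criterion O1. -/
theorem sched324_valid : sched324.Valid := ⟨by decide, by decide⟩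

/-- The three circuits are pairwise different (as one-cycle event lists). -/
theorem sched_templates_ne :
    sched345.template ≠ sched204.template ∧ sched324.template ≠ sched204.template ∧ sched345.template ≠ sched324.template := by
  decide

/-- ANCHOR, one cycle: the schedule layer renders print's order as EXACTLY the landed `cycleEvents`. -/
theorem template_sched204 : sched204.template = cycleEvents 0 := by decide

/-- ANCHOR: `cycleEventsₛ sched204 = cycleEvents`. -/
theorem cycleEventsₛ_sched204 (c : ℕ) : cycleEventsₛ sched204 c = cycleEvents c := by
  rw [cycleEventsₛ, template_sched204]; rfl

/-- ANCHOR: `allEventsₛ sched204 = allEvents`. -/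
theorem allEventsₛ_sched204 (Nc : ℕ) : allEventsₛ sched204 Nc = allEvents Nc := by
  simp only [allEventsₛ, allEvents, cycleEventsₛ_sched204]

section
variable [NeZero ℓ] [NeZero m]

/-- ANCHOR: for print's order the variant distance IS the landed `circuitDistance`, for every circuit data `S` and every `Nc`. -/
theorem circuitDistanceₛ_sched204 (S : SMCode ℓ m) (Nc : ℕ) : circuitDistanceₛ sched204 S Nc = circuitDistance S Nc := by
  unfold circuitDistanceₛ; rw [allEventsₛ_sched204]; exact Gen.circuitDistance_allEvents S Nc

/-- ANCHOR (fault-set form). -/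
theorem hasLogicalFaultOfWeightAtMostAtₛ_sched204 (S : SMCode ℓ m) (Nc w : ℕ) :
    HasLogicalFaultOfWeightAtMostAtₛ sched204 S Nc w ↔ HasLogicalFaultOfWeightAtMostAt S Nc w := by
  unfold HasLogicalFaultOfWeightAtMostAtₛ; rw [allEventsₛ_sched204, Gen.hasLogicalFaultOfWeightAtMostAt_allEvents]

/-- ANCHOR (some-`Nc` form): the ₛ-question for print's order is the landed one (e.g. at `S = bb144SM`, `w = 9` it is `CDX_Q2`). -/
theorem hasLogicalFaultOfWeightAtMostₛ_sched204 (S : SMCode ℓ m) (w : ℕ) :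
    HasLogicalFaultOfWeightAtMostₛ sched204 S w ↔ HasLogicalFaultOfWeightAtMost S w := by
  simp only [HasLogicalFaultOfWeightAtMostₛ, HasLogicalFaultOfWeightAtMost, hasLogicalFaultOfWeightAtMostAtₛ_sched204]

/-- ANCHOR (undetectability, for bridge files). -/
theorem undetectableₛ_sched204 (S : SMCode ℓ m) (Nc : ℕ) (F : Finset (Fault ℓ m)) :
    Undetectableₛ sched204 S Nc F ↔ Undetectable S Nc F := by
  unfold Undetectableₛ; rw [allEventsₛ_sched204, Gen.undetectable_allEvents]

/-- ANCHOR (logical error). -/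
theorem logicalErrorₛ_sched204 (S : SMCode ℓ m) (Nc : ℕ) (F : Finset (Fault ℓ m)) :
    LogicalErrorₛ sched204 S Nc F ↔ LogicalError S Nc F := by
  unfold LogicalErrorₛ; rw [allEventsₛ_sched204, Gen.logicalError_allEvents]

/-- ANCHOR (single-fault runs). -/
theorem run1ₛ_sched204 (S : SMCode ℓ m) (Nc : ℕ) : run1ₛ sched204 S Nc = run1 S Nc := by
  funext f; unfold run1ₛ; rw [allEventsₛ_sched204, Gen.run1_allEvents]

end

/-- The one-cycle NETLIST of #345, explicitly (audit aid; agrees with cdx/idea-2/fibres/q4_345/order345_netlist_and_validity.txt and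
crit-1's gen-C schedule line 2026-08-28T23:14:03Z). -/
theorem cycleEventsₛ_sched345 (c : ℕ) : cycleEventsₛ sched345 c =
    [.initX c, .cnot c .A2RZ, .idle c .L1,            -- R1
     .cnot c .A3XL, .cnot c .A1RZ,                     -- R2
     .cnot c .B1XR, .cnot c .B2LZ,                     -- R3
     .cnot c .B3XR, .cnot c .B3LZ,                     -- R4
     .cnot c .B2XR, .cnot c .B1LZ,                     -- R5
     .cnot c .A1XL, .cnot c .A3RZ,                     -- R6
     .cnot c .A2XL, .measZ c, .idle c .R7,             -- R7
     .measX c, .initZ c, .idle c .L8, .idle c .R8] := by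
  have h : sched345.template =
    [.initX 0, .cnot 0 .A2RZ, .idle 0 .L1, .cnot 0 .A3XL, .cnot 0 .A1RZ, .cnot 0 .B1XR, .cnot 0 .B2LZ, .cnot 0 .B3XR, .cnot 0 .B3LZ,
     .cnot 0 .B2XR, .cnot 0 .B1LZ, .cnot 0 .A1XL, .cnot 0 .A3RZ, .cnot 0 .A2XL, .measZ 0, .idle 0 .R7,
     .measX 0, .initZ 0, .idle 0 .L8, .idle 0 .R8] := by decide
  rw [cycleEventsₛ, h]; rfl

/-- The one-cycle netlist of #324: R1 `InitX, A₁(R→Z)` | R2 `A₃(X→L), A₂(R→Z)` | R3 `B₁(X→R), B₁(L→Z)` | R4 `B₂, B₂` | R5 `B₃, B₃` |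
R6 `A₁(X→L), A₃(R→Z)` | R7 `A₂(X→L), MeasZ` | R8. -/
theorem cycleEventsₛ_sched324 (c : ℕ) : cycleEventsₛ sched324 c =
    [.initX c, .cnot c .A1RZ, .idle c .L1, .cnot c .A3XL, .cnot c .A2RZ, .cnot c .B1XR, .cnot c .B1LZ, .cnot c .B2XR, .cnot c .B2LZ,
     .cnot c .B3XR, .cnot c .B3LZ, .cnot c .A1XL, .cnot c .A3RZ, .cnot c .A2XL, .measZ c, .idle c .R7,
     .measX c, .initZ c, .idle c .L8, .idle c .R8] := by
  have h : sched324.template =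
    [.initX 0, .cnot 0 .A1RZ, .idle 0 .L1, .cnot 0 .A3XL, .cnot 0 .A2RZ, .cnot 0 .B1XR, .cnot 0 .B1LZ, .cnot 0 .B2XR, .cnot 0 .B2LZ,
     .cnot 0 .B3XR, .cnot 0 .B3LZ, .cnot 0 .A1XL, .cnot 0 .A3RZ, .cnot 0 .A2XL, .measZ 0, .idle 0 .R7,
     .measX 0, .initZ 0, .idle 0 .L8, .idle 0 .R8] := by decide
  rw [cycleEventsₛ, h]; rfl

/-- THE ANCHOR OF RECORD (R153 (1)(b)): every word of record about print's `[[144,12,12]]` circuit is the `sched204` instance. -/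
theorem circuitDistanceₛ_sched204_bb144 (Nc : ℕ) : circuitDistanceₛ sched204 bb144SM Nc = circuitDistance bb144SM Nc :=
  circuitDistanceₛ_sched204 bb144SM Nc

end Summit.Ventures.QEC.CircuitDistance
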